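import Mathlib
import HarnessLib
import Summits.Ventures.LatticeQCDFlow.Exactness.SampleESS

/-!
# A constant work offset is invisible to every self-diagnostic and shifts `dF` by exactly itself

HONEST FRAMING: exact (Metropolis-corrected) sampling algorithms for lattice gauge theory;
figures of merit are autocorrelation/cost numbers at stated couplings and volumes; no
continuum-physics claim.

Venture `LatticeQCDFlow` (cell pub-lqcd), topic `Exactness`; FANOUT row 13 (`eng-snf`, GEN-25).
NEW WORK of the cell (elementary algebra) on the BUILT parent `Exactness/SampleESS` (`essHat`);
Mathlib otherwise; not a published result; no definition; nothing cited as a fact.  Companion of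
GEN-25 `…MeanWorkTruncation` (the planted `INVALID-3` IS visible by recomputation); this file is
the opposite case for the planted `PI-3` (`controls.X-3b`: "a reweight row whose work OMITS the
log-det term of the deterministic layers").

WHY (row 13).  If the omitted log-det is the SAME constant `c` on every record (volume change of
the deterministic layers independent of the configuration), the recorded works are `W_i + c`
instead of `W_i`, i.e. the importance weights are all multiplied by `e^{−c}`.  Then, exactly:

* `essHat` is unchanged (`essHat_const_mul`, `essHat_exp_neg_add_const`) — the Kish fraction is
  scale-free;
* every reweighted mean `Σ w O / Σ w` is unchanged (`weightedRatio_const_mul`);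
* `dF = −log mean e^{−W}` shifts by exactly `c` (`neg_log_avg_exp_neg_add_const`), and so does
  every delete-one-block replicate, hence `dF_biascorr` shifts by `c`
  (`jackknife_biasCorrected_add_const`) while `dF_err` is unchanged
  (`jackknife_variance_add_const`);
* `kl = mean_W − dF` is unchanged (`kl_add_const`).

So NO single-run self-diagnostic the engine prints (`ess`, `kl`, `*_err`, reweighted
observables, sector weights) can see a constant log-det omission; only the comparison with an
exact reference `ΔF` (the release test's `ref-exact`) can, and it sees exactly `c`.  (When the
omitted log-det VARIES across records the weights themselves are distorted and the diagnostics do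
move — nothing is claimed about that case.)

NOT CLAIMED: anything stochastic; the non-constant case; anything numerical.
-/

namespace Summit.Ventures.LatticeQCDFlow.Exactness.GeneralNCMC

open Finset Summit.Ventures.LatticeQCDFlow.Exactness

section Offset

variable {ι : Type*} [Fintype ι]

/-- **The Kish fraction is scale-free**: `essHat (c·w) = essHat w` for `c ≠ 0`. -/
theorem essHat_const_mul (w : ι → ℝ) {c : ℝ} (hc : c ≠ 0) :
    essHat (fun i => c * w i) = essHat w := by
  unfold essHat
  have h1 : ∑ i, c * w i = c * ∑ i, w i := by rw [mul_sum]
  have h2 : ∑ i, (c * w i) ^ 2 = c ^ 2 * ∑ i, w i ^ 2 := by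
    rw [mul_sum]; exact sum_congr rfl fun i _ => by ring
  rw [h1, h2]
  rcases eq_or_ne (∑ i, w i ^ 2) 0 with h0 | h0
  · simp [h0]
  · rw [mul_pow]
    field_simp

/-- **A constant work offset leaves `ess` unchanged**:
`essHat (e^{−(W + c)}) = essHat (e^{−W})`. -/
theorem essHat_exp_neg_add_const (W : ι → ℝ) (c : ℝ) :
    essHat (fun i => Real.exp (-(W i + c))) = essHat (fun i => Real.exp (-W i)) := by
  have h : (fun i => Real.exp (-(W i + c))) = fun i => Real.exp (-c) * Real.exp (-W i) := by
    funext i; rw [neg_add, Real.exp_add, mul_comm]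
  rw [h, essHat_const_mul _ (Real.exp_pos _).ne']

omit [Fintype ι] in
/-- **Reweighted means are unchanged**: `Σ (c w_i) O_i / Σ (c w_i) = Σ w_i O_i / Σ w_i`
(`c ≠ 0`). -/
theorem weightedRatio_const_mul (s : Finset ι) (w O : ι → ℝ) {c : ℝ} (hc : c ≠ 0) :
    (∑ i ∈ s, c * w i * O i) / (∑ i ∈ s, c * w i) = (∑ i ∈ s, w i * O i) / (∑ i ∈ s, w i) := by
  have h1 : ∑ i ∈ s, c * w i * O i = c * ∑ i ∈ s, w i * O i := by
    rw [mul_sum]; exact sum_congr rfl fun i _ => by ring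
  rw [h1, ← mul_sum, mul_div_mul_left _ _ hc]

omit [Fintype ι] in
/-- **`dF` shifts by exactly the offset**:
`−log((1/|s|)Σ e^{−(W_i + c)}) = c − log((1/|s|)Σ e^{−W_i})` on any nonempty subsample `s`
(so every delete-one-block replicate shifts by `c` too). -/
theorem neg_log_avg_exp_neg_add_const (s : Finset ι) (hs : s.Nonempty) (W : ι → ℝ) (c : ℝ) :
    -Real.log ((∑ i ∈ s, Real.exp (-(W i + c))) / s.card)
      = c + -Real.log ((∑ i ∈ s, Real.exp (-W i)) / s.card) := by
  have h : ∑ i ∈ s, Real.exp (-(W i + c)) = Real.exp (-c) * ∑ i ∈ s, Real.exp (-W i) := by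
    rw [mul_sum]; exact sum_congr rfl fun i _ => by rw [neg_add, Real.exp_add, mul_comm]
  have hpos : 0 < (∑ i ∈ s, Real.exp (-W i)) / s.card :=
    div_pos (sum_pos (fun i _ => Real.exp_pos _) hs) (by exact_mod_cast hs.card_pos)
  rw [h, mul_div_assoc, Real.log_mul (Real.exp_pos _).ne' hpos.ne', Real.log_exp]
  ring

omit [Fintype ι] in
/-- **`kl = mean_W − dF` is unchanged** by a constant offset. -/
theorem kl_add_const (s : Finset ι) (hs : s.Nonempty) (W : ι → ℝ) (c : ℝ) :
    (∑ i ∈ s, (W i + c)) / s.card - -Real.log ((∑ i ∈ s, Real.exp (-(W i + c))) / s.card)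
      = (∑ i ∈ s, W i) / s.card - -Real.log ((∑ i ∈ s, Real.exp (-W i)) / s.card) := by
  have hc : (s.card : ℝ) ≠ 0 := by exact_mod_cast hs.card_pos.ne'
  rw [neg_log_avg_exp_neg_add_const s hs W c, sum_add_distrib, sum_const, nsmul_eq_mul, add_div,
    mul_div_cancel_left₀ _ hc]
  ring

/-- **The jackknife error is offset-blind**: shifting every replicate by `c` leaves
`((g−1)/g)Σ_r (rep_r − rep_{(·)})²` unchanged (`R ≥ 1` replicates). -/
theorem jackknife_variance_add_const [Nonempty ι] (g c : ℝ) (rep : ι → ℝ) :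
    (g - 1) / g * ∑ r, ((rep r + c) - (∑ s, (rep s + c)) / Fintype.card ι) ^ 2
      = (g - 1) / g * ∑ r, (rep r - (∑ s, rep s) / Fintype.card ι) ^ 2 := by
  have hR : (Fintype.card ι : ℝ) ≠ 0 := by positivity
  congr 1
  refine sum_congr rfl fun r _ => ?_
  rw [sum_add_distrib, sum_const, card_univ, nsmul_eq_mul, add_div, mul_div_cancel_left₀ _ hR]
  ring

/-- **The bias-corrected value shifts by exactly `c`** (with `R` blocks = replicates). -/
theorem jackknife_biasCorrected_add_const [Nonempty ι] (f c : ℝ) (rep : ι → ℝ) :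
    (Fintype.card ι : ℝ) * (f + c)
          - ((Fintype.card ι : ℝ) - 1) * ((∑ r, (rep r + c)) / Fintype.card ι)
      = ((Fintype.card ι : ℝ) * f - ((Fintype.card ι : ℝ) - 1) * ((∑ r, rep r) / Fintype.card ι))
          + c := by
  have hR : (Fintype.card ι : ℝ) ≠ 0 := by positivity
  rw [sum_add_distrib, sum_const, card_univ, nsmul_eq_mul, add_div, mul_div_cancel_left₀ _ hR]
  ring

end Offset

end Summit.Ventures.LatticeQCDFlow.Exactness.GeneralNCMC
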